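import Summits.CriticalPhenomena.PercolationContinuityZ3.Theorems.PercNearOneGluingNoHeavyLowerTailThreePartitionGridTransport
import Literature.Probability.Percolation.FoldingFibresHarris
import Mathlib.Combinatorics.Hall.Basic
import HarnessLib.Audit

/-!
# `NoHeavyLowerTail` (crux stmt-CriticalPhenomena-4575), master-family hierarchy P3 (gen 34): the STRICT KLEITMAN PAIRING on a folding
# fibre, and the copies of a configuration read on its x₂-fibre

Support file (seat `prim-masterthm-p3`; `--supports stmt-CriticalPhenomena-4575`; memo
`run/shared/lean/prim/prim-masterthm/FROM-prim-masterthm-p3-g34-FIBRE-LOCAL-CERTIFICATE.md` §8a, HIERARCHY §41).  Toolkit for typed token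
matchings of the grid-transport kernel (`…ThreePartitionGridMatching`), used first in `…ThreePartitionGridTop` (`TypedMatchable τ ⊤ 𝒲`).
(1) **`exists_fibre_pairing`**: for an up-set `𝒲 ⊆ Set ι` and a folding fibre `F = {a : a \ M = u}` of
`Literature.Probability.Percolation.FoldingFibre` with its reflection `a ↦ a ∆ M`, the 'bad' points `{a ∈ F : a ∉ 𝒲, a ∆ M ∈ 𝒲}`
(`= σ𝒲 ∖ 𝒲` on the fibre) are matched BIJECTIVELY and increasingly (`a ⊆ g a`) onto the 'sites' `{b ∈ F : b ∈ 𝒲, b ∆ M ∉ 𝒲}` (`= 𝒲 ∖ σ𝒲`):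
Hall's condition is the fibrewise Harris inequality `FoldingFibre.fibreCount_le_of_isUpperSet` (the common part `F ∩ 𝒴 ∩ 𝒲 ∩ σ𝒲`
cancels), the matching is Mathlib's `Finset.all_card_le_biUnion_card_iff_exists_injective`, and the two sides have equal size by the
reflection.  This is the x₂-fibre step of the typed matching (memo §8a: an a-landing keeps copy 2).
(2) The copies of a configuration `q = (S₁,S₂)` on its x₂-fibre: `x₁ \ S₂ᶜ = τ ∩ S₂` (copy 1 lies on the folding fibre `(S₂ᶜ, τ ∩ S₂)`),
`x₃ = x₁ ∆ S₂ᶜ` (copy 3 is its reflection), the mirror statements for copy 2, and the reconstruction of a configuration from a point of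
the fibre (`((a ∆ τ) \ S) ∆ τ = a`).
HONEST LABEL: a cube lemma (Hall + Harris) and bookkeeping; nothing here bears on the crux. [this work]
-/

noncomputable section

open Finset
open scoped symmDiff Classical

namespace Summit.CriticalPhenomena.PercolationContinuityZ3.Theorems.ThreePartition

open Literature.Probability.Percolation (FoldingFibre.fibreCount_le_of_isUpperSet)

variable {ι : Type*} [Fintype ι]

/-! ## The strict Kleitman pairing on a folding fibre -/

/-- **Strict Kleitman pairing on a folding fibre.**  For an up-set `𝒲` and a folding fibre `F = {a : a \ M = u}` with reflection
`a ↦ a ∆ M`: the 'bad' points `{a ∈ F : a ∉ 𝒲, a ∆ M ∈ 𝒲}` are matched BIJECTIVELY and increasingly (`a ⊆ g a`) onto the 'sites'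
`{b ∈ F : b ∈ 𝒲, b ∆ M ∉ 𝒲}`.  Hall's condition for a set `Z` of bad points with up-closure `𝒴`:
`#(sites in 𝒴) − #(bad in 𝒴) = #{a ∈ F ∩ 𝒴 ∩ 𝒲} − #{a ∈ F ∩ 𝒴 : a ∆ M ∈ 𝒲} ≥ 0` (fibrewise Harris); the two sides have the same size
(reflection). [this work] -/
theorem exists_fibre_pairing {𝒲 : Set (Set ι)} (h𝒲 : IsUpperSet 𝒲) (M u : Set ι) :
    ∃ g : Set ι → Set ι,
      Set.BijOn g (↑(univ.filter fun a : Set ι => a \ M = u ∧ a ∉ 𝒲 ∧ a ∆ M ∈ 𝒲))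
        (↑(univ.filter fun b : Set ι => b \ M = u ∧ b ∈ 𝒲 ∧ b ∆ M ∉ 𝒲)) ∧
      ∀ a : Set ι, a \ M = u → a ∉ 𝒲 → a ∆ M ∈ 𝒲 → a ⊆ g a := by
  -- opaque names for the two sides
  obtain ⟨Bad, hBad⟩ : ∃ Bad : Finset (Set ι), ∀ a, a ∈ Bad ↔ a \ M = u ∧ a ∉ 𝒲 ∧ a ∆ M ∈ 𝒲 :=
    ⟨univ.filter fun a : Set ι => a \ M = u ∧ a ∉ 𝒲 ∧ a ∆ M ∈ 𝒲, fun a => by simp only [mem_filter, mem_univ, true_and]⟩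
  obtain ⟨Site, hSite⟩ : ∃ Site : Finset (Set ι), ∀ b, b ∈ Site ↔ b \ M = u ∧ b ∈ 𝒲 ∧ b ∆ M ∉ 𝒲 :=
    ⟨univ.filter fun b : Set ι => b \ M = u ∧ b ∈ 𝒲 ∧ b ∆ M ∉ 𝒲, fun b => by simp only [mem_filter, mem_univ, true_and]⟩
  have eBad : (univ.filter fun a : Set ι => a \ M = u ∧ a ∉ 𝒲 ∧ a ∆ M ∈ 𝒲) = Bad := by
    ext a; rw [mem_filter, hBad]; simp only [mem_univ, true_and]
  have eSite : (univ.filter fun b : Set ι => b \ M = u ∧ b ∈ 𝒲 ∧ b ∆ M ∉ 𝒲) = Site := by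
    ext b; rw [mem_filter, hSite]; simp only [mem_univ, true_and]
  rw [eBad, eSite]
  -- equal sizes (the reflection `a ↦ a ∆ M` swaps the two sides)
  have hrefl : ∀ a : Set ι, a \ M = u → (a ∆ M) \ M = u := fun a ha =>
    Literature.Probability.Percolation.FoldingFibre.mem_fibre.1
      (Literature.Probability.Percolation.FoldingFibre.symmDiff_mem_fibre
        (Literature.Probability.Percolation.FoldingFibre.mem_fibre.2 ha))
  have hcard : #Site = #Bad := by
    refine card_nbij' (fun b => b ∆ M) (fun a => a ∆ M) (fun b hb => ?_) (fun a ha => ?_)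
      (fun b _ => symmDiff_symmDiff_cancel_right _ _) (fun a _ => symmDiff_symmDiff_cancel_right _ _)
    · rw [mem_coe, hSite] at hb
      rw [mem_coe, hBad, symmDiff_symmDiff_cancel_right]
      exact ⟨hrefl b hb.1, hb.2.2, hb.2.1⟩
    · rw [mem_coe, hBad] at ha
      rw [mem_coe, hSite, symmDiff_symmDiff_cancel_right]
      exact ⟨hrefl a ha.1, ha.2.2, ha.2.1⟩
  -- Hall's condition
  let t : Bad → Finset (Set ι) := fun a => Site.filter fun b => a.1 ⊆ b
  have hHall : ∀ s : Finset Bad, #s ≤ #(s.biUnion t) := by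
    intro s
    obtain ⟨𝒴, h𝒴mem⟩ : ∃ 𝒴 : Set (Set ι), ∀ b, b ∈ 𝒴 ↔ ∃ a ∈ s, a.1 ⊆ b :=
      ⟨{b | ∃ a ∈ s, a.1 ⊆ b}, fun _ => Iff.rfl⟩
    have h𝒴 : IsUpperSet 𝒴 := by
      intro b b' hbb' hb
      obtain ⟨a, ha, hab⟩ := (h𝒴mem b).1 hb
      exact (h𝒴mem b').2 ⟨a, ha, hab.trans hbb'⟩
    have hbi : s.biUnion t = Site.filter fun b => b ∈ 𝒴 := by
      ext b
      simp only [mem_biUnion, mem_filter, t, h𝒴mem]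
      constructor
      · rintro ⟨a, ha, hb, hab⟩
        exact ⟨hb, a, ha, hab⟩
      · rintro ⟨hb, a, ha, hab⟩
        exact ⟨a, ha, hb, hab⟩
    have hs : #s ≤ #(Bad.filter fun a => a ∈ 𝒴) := by
      calc #s = #(s.map (Function.Embedding.subtype _)) := (card_map _).symm
        _ ≤ #(Bad.filter fun a => a ∈ 𝒴) := by
          refine card_le_card fun a ha => ?_
          obtain ⟨a', ha', rfl⟩ := mem_map.1 ha
          exact mem_filter.2 ⟨a'.2, (h𝒴mem _).2 ⟨a', ha', subset_rfl⟩⟩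
    -- fibrewise Harris: #{F ∩ 𝒴 : a ∆ M ∈ 𝒲} ≤ #{F ∩ 𝒴 ∩ 𝒲}
    have hH := FoldingFibre.fibreCount_le_of_isUpperSet h𝒴 h𝒲 M u
    -- split both Harris counts along `a ∈ 𝒲` resp. `a ∆ M ∈ 𝒲`; the common part cancels
    have eX : #(univ.filter fun a : Set ι => a \ M = u ∧ a ∈ 𝒴 ∧ a ∆ M ∈ 𝒲)
        = #(Bad.filter fun a => a ∈ 𝒴) + #(univ.filter fun a : Set ι => a \ M = u ∧ a ∈ 𝒴 ∧ a ∈ 𝒲 ∧ a ∆ M ∈ 𝒲) := by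
      rw [← card_filter_add_card_filter_not (s := univ.filter fun a : Set ι => a \ M = u ∧ a ∈ 𝒴 ∧ a ∆ M ∈ 𝒲)
        (fun a : Set ι => a ∉ 𝒲)]
      congr 1
      · congr 1
        ext a
        simp only [mem_filter, mem_univ, true_and, hBad]
        tauto
      · congr 1
        ext a
        simp only [mem_filter, mem_univ, true_and, not_not]
        tauto
    have eY : #(univ.filter fun a : Set ι => a \ M = u ∧ a ∈ 𝒴 ∩ 𝒲 ∧ a ∆ M ∈ (Set.univ : Set (Set ι)))
        = #(Site.filter fun b => b ∈ 𝒴) + #(univ.filter fun a : Set ι => a \ M = u ∧ a ∈ 𝒴 ∧ a ∈ 𝒲 ∧ a ∆ M ∈ 𝒲) := by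
      rw [← card_filter_add_card_filter_not (s := univ.filter fun a : Set ι =>
          a \ M = u ∧ a ∈ 𝒴 ∩ 𝒲 ∧ a ∆ M ∈ (Set.univ : Set (Set ι))) (fun a : Set ι => a ∆ M ∉ 𝒲)]
      congr 1
      · congr 1
        ext a
        simp only [mem_filter, mem_univ, true_and, hSite, Set.mem_inter_iff, Set.mem_univ, and_true]
        tauto
      · congr 1
        ext a
        simp only [mem_filter, mem_univ, true_and, not_not, Set.mem_inter_iff, Set.mem_univ, and_true]
        tauto
    rw [hbi]
    omega
  obtain ⟨f, hf, hft⟩ := (all_card_le_biUnion_card_iff_exists_injective t).1 hHall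
  let g : Set ι → Set ι := fun a => if h : a ∈ Bad then f ⟨a, h⟩ else a
  have hg_of : ∀ a (h : a ∈ Bad), g a = f ⟨a, h⟩ := fun a h => by simp only [g, dif_pos h]
  have hmaps : Set.MapsTo g ↑Bad ↑Site := by
    intro a ha
    rw [mem_coe] at ha ⊢
    rw [hg_of a ha]
    exact (mem_filter.1 (hft ⟨a, ha⟩)).1
  have hinj : Set.InjOn g ↑Bad := by
    intro a ha a' ha' h
    rw [mem_coe] at ha ha'
    rw [hg_of a ha, hg_of a' ha'] at h
    exact congrArg Subtype.val (hf h)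
  refine ⟨g, ⟨hmaps, hinj, surjOn_of_injOn_of_card_le g hmaps hinj hcard.le⟩, fun a h1 h2 h3 => ?_⟩
  have ha : a ∈ Bad := (hBad a).2 ⟨h1, h2, h3⟩
  rw [hg_of a ha]
  exact (mem_filter.1 (hft ⟨a, ha⟩)).2

/-! ## Copies on an x₂-fibre: the folding fibre `(S₂ᶜ, τ ∩ S₂)` and its reflection -/


omit [Fintype ι] in
/-- On a configuration, copy 1 agrees with `τ` on the second part: `x₁ \ S₂ᶜ = τ ∩ S₂` (copy 1 lies on the folding fibre
`(S₂ᶜ, τ ∩ S₂)`). [this work] -/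
theorem cp₁_sdiff_compl_snd (τ : Set ι) {q : Set ι × Set ι} (hq : Disjoint q.1 q.2) : cp₁ τ q \ q.2ᶜ = τ ∩ q.2 := by
  ext x
  have hx : x ∈ q.1 → x ∉ q.2 := fun h1 h2 => Set.disjoint_left.1 hq h1 h2
  simp only [cp₁, Set.mem_sdiff, Set.mem_compl_iff, not_not, Set.mem_symmDiff, Set.mem_inter_iff]
  tauto

omit [Fintype ι] in
/-- Symmetrically, copy 2 agrees with `τ` on the first part. [this work] -/
theorem cp₂_sdiff_compl_fst (τ : Set ι) {q : Set ι × Set ι} (hq : Disjoint q.1 q.2) : cp₂ τ q \ q.1ᶜ = τ ∩ q.1 := by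
  ext x
  have hx : x ∈ q.1 → x ∉ q.2 := fun h1 h2 => Set.disjoint_left.1 hq h1 h2
  simp only [cp₂, Set.mem_sdiff, Set.mem_compl_iff, not_not, Set.mem_symmDiff, Set.mem_inter_iff]
  tauto

omit [Fintype ι] in
/-- Copy 3 is the reflection of copy 1 across the complement of the second part: `x₃ = x₁ ∆ S₂ᶜ`. [this work] -/
theorem cp₃_eq_cp₁_symmDiff (τ : Set ι) {q : Set ι × Set ι} (hq : Disjoint q.1 q.2) : cp₃ τ q = cp₁ τ q ∆ q.2ᶜ := by
  ext x
  have hx : x ∈ q.1 → x ∉ q.2 := fun h1 h2 => Set.disjoint_left.1 hq h1 h2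
  simp only [cp₃, cp₁, Set.mem_symmDiff, Set.mem_compl_iff, Set.mem_union]
  tauto

omit [Fintype ι] in
/-- … and the reflection of copy 2 across the complement of the first part: `x₃ = x₂ ∆ S₁ᶜ`. [this work] -/
theorem cp₃_eq_cp₂_symmDiff (τ : Set ι) {q : Set ι × Set ι} (hq : Disjoint q.1 q.2) : cp₃ τ q = cp₂ τ q ∆ q.1ᶜ := by
  ext x
  have hx : x ∈ q.1 → x ∉ q.2 := fun h1 h2 => Set.disjoint_left.1 hq h1 h2
  simp only [cp₃, cp₂, Set.mem_symmDiff, Set.mem_compl_iff, Set.mem_union]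
  tauto

omit [Fintype ι] in
/-- Reconstruction: a point `a` of the folding fibre `(Sᶜ, τ ∩ S)` is copy 1 of the configuration `((a ∆ τ) \ S, S)` (and copy 2 of
its mirror `(S, (a ∆ τ) \ S)`): `((a ∆ τ) \ S) ∆ τ = a`. [this work] -/
theorem symmDiff_sdiff_symmDiff_of_fibre (τ : Set ι) {S a : Set ι} (ha : a \ Sᶜ = τ ∩ S) : ((a ∆ τ) \ S) ∆ τ = a := by
  ext x
  have hx := Set.ext_iff.1 ha x
  simp only [Set.mem_sdiff, Set.mem_compl_iff, not_not, Set.mem_inter_iff] at hx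
  simp only [Set.mem_symmDiff, Set.mem_sdiff]
  tauto

omit [Fintype ι] in
/-- Copy 3 of the reconstructed configuration `((a ∆ τ) \ S, S)` is the reflection `a ∆ Sᶜ`. [this work] -/
theorem cp₃_mk_fst (τ : Set ι) {S a : Set ι} (ha : a \ Sᶜ = τ ∩ S) :
    cp₃ τ ((a ∆ τ) \ S, S) = a ∆ Sᶜ := by
  have hd : Disjoint ((a ∆ τ) \ S) S := Set.disjoint_sdiff_left
  rw [cp₃_eq_cp₁_symmDiff τ (q := ((a ∆ τ) \ S, S)) hd]
  show (((a ∆ τ) \ S) ∆ τ) ∆ Sᶜ = a ∆ Sᶜ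
  rw [symmDiff_sdiff_symmDiff_of_fibre τ ha]

omit [Fintype ι] in
/-- Copy 3 of the mirror configuration `(S, (a ∆ τ) \ S)` is the same reflection `a ∆ Sᶜ`. [this work] -/
theorem cp₃_mk_snd (τ : Set ι) {S a : Set ι} (ha : a \ Sᶜ = τ ∩ S) :
    cp₃ τ (S, (a ∆ τ) \ S) = a ∆ Sᶜ := by
  have hd : Disjoint S ((a ∆ τ) \ S) := Set.disjoint_sdiff_right
  rw [cp₃_eq_cp₂_symmDiff τ (q := (S, (a ∆ τ) \ S)) hd]
  show (((a ∆ τ) \ S) ∆ τ) ∆ Sᶜ = a ∆ Sᶜ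
  rw [symmDiff_sdiff_symmDiff_of_fibre τ ha]

/-! ## Appendix (late gen 34): the relative pairing (injective form, two up-sets) and the copies on an x₃-fibre -/

/-- **Relative Kleitman pairing on a folding fibre (injective form).**  For up-sets `𝒜, ℬ` and a folding fibre `F = {a : a \ M = u}`: the
points `{a ∈ F : a ∈ 𝒜, a ∉ ℬ, a ∆ M ∈ ℬ}` inject increasingly (`a ⊆ g a`) into `{b ∈ F : b ∈ 𝒜 ∩ ℬ, b ∆ M ∉ ℬ}` — Hall's condition for `Z` with
up-closure `𝒴` is the fibrewise Harris inequality for `(𝒴 ∩ 𝒜, ℬ)`.  With `𝒜 = ⊤` this is the injective half of `exists_fibre_pairing`; with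
`(𝒜, ℬ) = (𝒲, 𝒱)` on an x₃-fibre it sends the `N2` tokens outside `P` to free units `b` (memo §8c). [this work] -/
theorem exists_fibre_injection {𝒜 ℬ : Set (Set ι)} (h𝒜 : IsUpperSet 𝒜) (hℬ : IsUpperSet ℬ) (M u : Set ι) :
    ∃ g : Set ι → Set ι,
      Set.InjOn g {a : Set ι | a \ M = u ∧ a ∈ 𝒜 ∧ a ∉ ℬ ∧ a ∆ M ∈ ℬ} ∧
      ∀ a : Set ι, a \ M = u → a ∈ 𝒜 → a ∉ ℬ → a ∆ M ∈ ℬ →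
        (g a \ M = u ∧ g a ∈ 𝒜 ∧ g a ∈ ℬ ∧ (g a) ∆ M ∉ ℬ) ∧ a ⊆ g a := by
  obtain ⟨T, hT⟩ : ∃ T : Finset (Set ι), ∀ a, a ∈ T ↔ a \ M = u ∧ a ∈ 𝒜 ∧ a ∉ ℬ ∧ a ∆ M ∈ ℬ :=
    ⟨univ.filter fun a : Set ι => a \ M = u ∧ a ∈ 𝒜 ∧ a ∉ ℬ ∧ a ∆ M ∈ ℬ, fun a => by simp only [mem_filter, mem_univ, true_and]⟩
  obtain ⟨S, hS⟩ : ∃ S : Finset (Set ι), ∀ b, b ∈ S ↔ b \ M = u ∧ b ∈ 𝒜 ∧ b ∈ ℬ ∧ b ∆ M ∉ ℬ :=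
    ⟨univ.filter fun b : Set ι => b \ M = u ∧ b ∈ 𝒜 ∧ b ∈ ℬ ∧ b ∆ M ∉ ℬ, fun b => by simp only [mem_filter, mem_univ, true_and]⟩
  let t : T → Finset (Set ι) := fun a => S.filter fun b => a.1 ⊆ b
  have hHall : ∀ s : Finset T, #s ≤ #(s.biUnion t) := by
    intro s
    obtain ⟨𝒴, h𝒴mem⟩ : ∃ 𝒴 : Set (Set ι), ∀ b, b ∈ 𝒴 ↔ ∃ a ∈ s, a.1 ⊆ b :=
      ⟨{b | ∃ a ∈ s, a.1 ⊆ b}, fun _ => Iff.rfl⟩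
    have h𝒴 : IsUpperSet 𝒴 := by
      intro b b' hbb' hb
      obtain ⟨a, ha, hab⟩ := (h𝒴mem b).1 hb
      exact (h𝒴mem b').2 ⟨a, ha, hab.trans hbb'⟩
    have hbi : s.biUnion t = S.filter fun b => b ∈ 𝒴 := by
      ext b
      simp only [mem_biUnion, mem_filter, t, h𝒴mem]
      constructor
      · rintro ⟨a, ha, hb, hab⟩
        exact ⟨hb, a, ha, hab⟩
      · rintro ⟨hb, a, ha, hab⟩
        exact ⟨a, ha, hb, hab⟩
    have hs : #s ≤ #(T.filter fun a => a ∈ 𝒴) := by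
      calc #s = #(s.map (Function.Embedding.subtype _)) := (card_map _).symm
        _ ≤ #(T.filter fun a => a ∈ 𝒴) := by
          refine card_le_card fun a ha => ?_
          obtain ⟨a', ha', rfl⟩ := mem_map.1 ha
          exact mem_filter.2 ⟨a'.2, (h𝒴mem _).2 ⟨a', ha', subset_rfl⟩⟩
    -- fibrewise Harris for the up-sets `𝒴 ∩ 𝒜` and `ℬ`, restated with explicit conjunctions (uniform decidability instances)
    have hH : #(univ.filter fun a : Set ι => a \ M = u ∧ (a ∈ 𝒴 ∧ a ∈ 𝒜) ∧ a ∆ M ∈ ℬ)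
        ≤ #(univ.filter fun a : Set ι => a \ M = u ∧ (a ∈ 𝒴 ∧ a ∈ 𝒜) ∧ a ∈ ℬ) := by
      have h := FoldingFibre.fibreCount_le_of_isUpperSet (h𝒴.inter h𝒜) hℬ M u
      refine le_trans (le_of_eq (congrArg Finset.card (Finset.ext fun a => ?_)))
        (le_trans h (le_of_eq (congrArg Finset.card (Finset.ext fun a => ?_))))
      · simp only [mem_filter, mem_univ, true_and, Set.mem_inter_iff]
      · simp only [mem_filter, mem_univ, true_and, Set.mem_inter_iff, Set.mem_univ, and_true]
    have eX : #(univ.filter fun a : Set ι => a \ M = u ∧ (a ∈ 𝒴 ∧ a ∈ 𝒜) ∧ a ∆ M ∈ ℬ)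
        = #(T.filter fun a => a ∈ 𝒴) + #(univ.filter fun a : Set ι => a \ M = u ∧ a ∈ 𝒴 ∧ a ∈ 𝒜 ∧ a ∈ ℬ ∧ a ∆ M ∈ ℬ) := by
      rw [← card_filter_add_card_filter_not (s := univ.filter fun a : Set ι => a \ M = u ∧ (a ∈ 𝒴 ∧ a ∈ 𝒜) ∧ a ∆ M ∈ ℬ)
        (fun a : Set ι => a ∉ ℬ)]
      congr 1
      · congr 1
        ext a
        simp only [mem_filter, mem_univ, true_and, hT]
        tauto
      · congr 1
        ext a
        simp only [mem_filter, mem_univ, true_and, not_not]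
        tauto
    have eY : #(univ.filter fun a : Set ι => a \ M = u ∧ (a ∈ 𝒴 ∧ a ∈ 𝒜) ∧ a ∈ ℬ)
        = #(S.filter fun b => b ∈ 𝒴) + #(univ.filter fun a : Set ι => a \ M = u ∧ a ∈ 𝒴 ∧ a ∈ 𝒜 ∧ a ∈ ℬ ∧ a ∆ M ∈ ℬ) := by
      rw [← card_filter_add_card_filter_not (s := univ.filter fun a : Set ι => a \ M = u ∧ (a ∈ 𝒴 ∧ a ∈ 𝒜) ∧ a ∈ ℬ)
        (fun a : Set ι => a ∆ M ∉ ℬ)]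
      congr 1
      · congr 1
        ext a
        simp only [mem_filter, mem_univ, true_and, hS]
        tauto
      · congr 1
        ext a
        simp only [mem_filter, mem_univ, true_and, not_not]
        tauto
    rw [hbi]
    omega
  obtain ⟨f, hf, hft⟩ := (all_card_le_biUnion_card_iff_exists_injective t).1 hHall
  let g : Set ι → Set ι := fun a => if h : a ∈ T then f ⟨a, h⟩ else a
  have hg_of : ∀ a (h : a ∈ T), g a = f ⟨a, h⟩ := fun a h => by simp only [g, dif_pos h]
  refine ⟨g, fun a ha a' ha' h => ?_, fun a h1 h2 h3 h4 => ?_⟩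
  · have haT : a ∈ T := (hT a).2 ha
    have haT' : a' ∈ T := (hT a').2 ha'
    rw [hg_of a haT, hg_of a' haT'] at h
    exact congrArg Subtype.val (hf h)
  · have ha : a ∈ T := (hT a).2 ⟨h1, h2, h3, h4⟩
    rw [hg_of a ha]
    have hm := mem_filter.1 (hft ⟨a, ha⟩)
    exact ⟨(hS _).1 hm.1, hm.2⟩

omit [Fintype ι] in
/-- On a configuration, copy 1 agrees with `τ` off the first two parts: `x₁ \ (S₁ ∪ S₂) = τ \ (S₁ ∪ S₂)` (copy 1 lies on the folding fibre
`(S₁ ∪ S₂, τ \ (S₁ ∪ S₂))` of the x₃-fibre). [this work] -/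
theorem cp₁_sdiff_union (τ : Set ι) (q : Set ι × Set ι) : cp₁ τ q \ (q.1 ∪ q.2) = τ \ (q.1 ∪ q.2) := by
  ext x
  simp only [cp₁, Set.mem_sdiff, Set.mem_symmDiff, Set.mem_union]
  tauto

omit [Fintype ι] in
/-- Copy 2 is the reflection of copy 1 across the first two parts: `x₂ = x₁ ∆ (S₁ ∪ S₂)`. [this work] -/
theorem cp₂_eq_cp₁_symmDiff_union (τ : Set ι) {q : Set ι × Set ι} (hq : Disjoint q.1 q.2) :
    cp₂ τ q = cp₁ τ q ∆ (q.1 ∪ q.2) := by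
  ext x
  have hx : x ∈ q.1 → x ∉ q.2 := fun h1 h2 => Set.disjoint_left.1 hq h1 h2
  simp only [cp₂, cp₁, Set.mem_symmDiff, Set.mem_union]
  tauto

omit [Fintype ι] in
/-- Reconstruction on an x₃-fibre: a point `b` of the folding fibre `(U, τ \ U)` is copy 1 of the configuration `((b ∆ τ) ∩ U, U \ ((b ∆ τ) ∩ U))`,
whose first two parts have union `U`: `((b ∆ τ) ∩ U) ∆ τ = b`. [this work] -/
theorem symmDiff_inter_symmDiff_of_fibre (τ : Set ι) {U b : Set ι} (hb : b \ U = τ \ U) : ((b ∆ τ) ∩ U) ∆ τ = b := by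
  ext x
  have hx := Set.ext_iff.1 hb x
  simp only [Set.mem_sdiff] at hx
  simp only [Set.mem_symmDiff, Set.mem_inter_iff]
  tauto

omit [Fintype ι] in
/-- The parts of the reconstructed configuration `((b ∆ τ) ∩ U, U \ ((b ∆ τ) ∩ U))` have union `U`. [this work] -/
theorem mk₃_union (τ : Set ι) (U b : Set ι) : ((b ∆ τ) ∩ U) ∪ (U \ ((b ∆ τ) ∩ U)) = U :=
  Set.union_sdiff_cancel Set.inter_subset_right

end Summit.CriticalPhenomena.PercolationContinuityZ3.Theorems.ThreePartition

end
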